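import Mathlib
import Summits.ValiantsHypothesis.ValiantsHypothesis.Theses.RigidityForcesSymmetry
import Summits.ValiantsHypothesis.ValiantsHypothesis.Theorems.RigidityForcesSymmetryRigidMinimalReprInfRigidToLocallyOpen

/-!
# Line `rank_slice` for support item `RigidityForcesSymmetry.RankInfRigidToLocallyOpen`
# (stmt-ValiantsHypothesis-24282 — sub-crux A2 of crux `RankRigidMinimalRepr`, stmt-18034)

THE RANK-CONSTRAINED SLICE LEMMA.  Coefficient space `X = M_m × (ι → M_m)`, base pencil `x₀ = (Λ, A)` with
`det x̃₀ = f ≠ 0`, gauge group `G = GL_m × GL_m` acting by `x ↦ g·x·h⁻¹`, gauge tangent space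
`T = {(PΛ + ΛQ, (PA_v + A_vQ)_v)}`, rank stratum `𝓜 = {x : rank x_v ≤ rank A_v ∀ v}` (a product of single-matrix
rank strata; `G·x₀ ⊆ 𝓜`).  Hypothesis (RANK-INFINITESIMAL RIGIDITY): every direction tangent to `{det = f}`
(`tr(adj x̃₀ · B̃) = 0`) AND rank-tangent (`B_v · ker A_v ⊆ im A_v`, i.e. `B_v ∈ T_{A_v}{rank ≤ r_v} = {P_vA_v + A_vQ_v}`)
is a gauge direction.  Conclusion: near `x₀`, `{det = f} ∩ 𝓜 ⊆ G·x₀`.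

The UNCONSTRAINED version is the tree theorem `stub_infRigidToLocallyOpen`
(`Theorems/RigidityForcesSymmetryRigidMinimalReprInfRigidToLocallyOpen.lean`: orbit–slice chart `stub_sliceOpen` by the
inverse function theorem + local injectivity on a linear slice `stub_pencilLocInj` by Jacobi's formula and an injective
differential).  The rank constraint makes the relevant slice CURVED (`(x₀ + W) ∩ 𝓜`); the line flattens it by writing the
`A`-coordinates of rank-constrained points in ORBIT-SECTION COORDINATES of the single matrices `A_v`:
`B = (1 + κ.1)·A_v·(1 + κ.2)` with `κ` small in a linear complement `C_v` of the stabiliser algebra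
`𝔰_v = {(a, b) : a A_v + A_v b = 0}` (every matrix of rank `≤ rank A_v` near `A_v` is of this form: `GL×GL`-orbit of a
single matrix = its rank stratum, locally, with a section — Schur complement / rank normal form).  In the flat coordinates
`(c, Λ', κ) ∈ ℂ × M_m × (ι → C_v)` the landed engine applies verbatim.

Stubs (2) + kernel-checked composition `RankInfRigidToLocallyOpen_of`:
* `stub_rankSliceCover` (M) — CONSTRAINED SLICE COVER: for a linear complement `W` of `T` there are complements `C_v` of the
  `𝔰_v` such that every rank-constrained `p` near `x₀` is `(1+P)·(x₀ + w)·(1+Q)` with `(P, Q)` small, `w ∈ W` small, and the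
  `A`-part of `x₀ + w` in section coordinates `((1+κ_v.1)A_v(1+κ_v.2))_v`, `κ_v ∈ C_v` small.
  (= tree `stub_sliceOpen` + rank invariance under `GL×GL` (`Matrix.rank_mul_eq_*_of_isUnit_det`) + the single-matrix
  orbit section near `A_v` + neighbourhood bookkeeping over the finite `ι`.)
* `stub_rankLocInj` (M/L, load-bearing) — FLAT LOCAL INJECTIVITY: for `(c, Λ', κ)` near `(1, 0, 0)` with `κ_v ∈ C_v`,
  `w := (Λ', ((1+κ_v.1)A_v(1+κ_v.2) − A_v)_v) ∈ W` and `det((x₀ + w)~) = c·f` force `(Λ', κ) = 0`.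
  (The map `Γ(c, Λ', κ) = ((Λ', σ(κ)) mod W, (det((x₀+w)(z)) − c f(z))_{z ∈ S})` on the flat space `ℂ × M_m × Π_v C_v`
  has injective differential at `(1, 0, 0)`: a kernel vector gives `B = (Λ'', (η_v.1 A_v + A_v η_v.2)_v)` with
  `tr(adj x̃₀ B̃) = γ f`; `B − (γ/m)·x₀` is det-tangent and rank-tangent, hence gauge by the hypothesis, so `B ∈ T`,
  `B mod W = 0` forces `B ∈ T ∩ W = 0`, then `η_v ∈ C_v ∩ 𝔰_v = 0` and `γ f(z₀) = 0 ⇒ γ = 0`; conclude with the tree lemmas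
  `hasFDerivAt_det_of_hasFDerivAt`, `exists_finset_forall_mem`, `eventually_eq_of_hasFDerivAt_of_ker_eq_bot`.)
Composition: the tree proof `infRigidToLocallyOpen_of_slice` transplanted (choose `W` by `Submodule.exists_isCompl`, pull the
flat neighbourhood back through `q ↦ ((det(1+P)·det(1+Q))⁻¹, Λ', κ)`, `det p̃ = det(1+P)·det((x₀+w)~)·det(1+Q)` by
`rft_map_C_mul_pencil_mul_map_C`).

Role: with A1 = `GrenetFirstOrderRankRigid` (stmt-21029, PROVED) this item gives `TightRankRigid` and the calibration
`RankRigidMinimalRepr ↔ GrenetLowerBound` (Cruxes/RankRigidMinimalRepr/CruxCalibration.lean `crux_iff_target`).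
Disproof used: none exists for this item (new item; `not_RigidMinimalRepr` concerns UNCONSTRAINED rigidity and is exactly why
the rank constraint is a hypothesis here — the Koszul row twist raises `rank A_v`, so it is not in `𝓜`).
-/

noncomputable section

set_option linter.dupNamespace false

namespace Summit.ValiantsHypothesis.ValiantsHypothesis.Cruxes.RankInfRigidToLocallyOpen.RankSlice

open MvPolynomial Matrix Filter Topology
open Summit.ValiantsHypothesis.ValiantsHypothesis.Theses.RigidityForcesSymmetry
open Summit.ValiantsHypothesis.ValiantsHypothesis.Theorems.RigidityForcesSymmetryRigidMinimalRepr

/-- **Stub 1 (M) — constrained slice cover.**  Given a linear slice `W` with `X = T + W`, there are linear complements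
`C_v` of the stabiliser algebras `𝔰_v = {c : c.1 A_v + A_v c.2 = 0}` (only `C_v ∩ 𝔰_v = 0` is recorded) such that for every
neighbourhood `V` of `0` some neighbourhood `U` of `(Λ, A)` has: every `p ∈ U` with `rank p_v ≤ rank A_v` for all `v` is
`(1+P)·(x₀ + w)·(1+Q)` with `q = ((P, Q), (Λ', κ)) ∈ V`, `κ_v ∈ C_v`, and `w = (Λ', ((1+κ_v.1)A_v(1+κ_v.2) − A_v)_v) ∈ W`.
Tree `stub_sliceOpen` + rank invariance under invertible `1+P`, `1+Q` + the local orbit section of a single matrix in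
its rank stratum (Schur complement near a rank normal form `g₀ A_v h₀ = [[1_r, 0], [0, 0]]`). -/
theorem stub_rankSliceCover :
    ∀ (ι : Type) [Fintype ι] (m : ℕ) (Λ : Matrix (Fin m) (Fin m) ℂ) (A : ι → Matrix (Fin m) (Fin m) ℂ)
      (W : Submodule ℂ (Matrix (Fin m) (Fin m) ℂ × (ι → Matrix (Fin m) (Fin m) ℂ))),
      (∀ x : Matrix (Fin m) (Fin m) ℂ × (ι → Matrix (Fin m) (Fin m) ℂ),
        ∃ (P Q : Matrix (Fin m) (Fin m) ℂ), ∃ w ∈ W,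
          x = (P * Λ + Λ * Q, fun v => P * A v + A v * Q) + w) →
      ∃ C : ι → Submodule ℂ (Matrix (Fin m) (Fin m) ℂ × Matrix (Fin m) (Fin m) ℂ),
        (∀ v, ∀ c ∈ C v, c.1 * A v + A v * c.2 = 0 → c = 0) ∧
        ∀ V ∈ nhds (0 : (Matrix (Fin m) (Fin m) ℂ × Matrix (Fin m) (Fin m) ℂ) ×
                      (Matrix (Fin m) (Fin m) ℂ × (ι → Matrix (Fin m) (Fin m) ℂ × Matrix (Fin m) (Fin m) ℂ))),
          ∃ U ∈ nhds (Λ, A), ∀ p ∈ U, (∀ v, (p.2 v).rank ≤ (A v).rank) →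
            ∃ q ∈ V, (∀ v, q.2.2 v ∈ C v) ∧
              ((q.2.1, fun v => (1 + (q.2.2 v).1) * A v * (1 + (q.2.2 v).2) - A v) :
                  Matrix (Fin m) (Fin m) ℂ × (ι → Matrix (Fin m) (Fin m) ℂ)) ∈ W ∧
              p = ((1 + q.1.1) * (Λ + q.2.1) * (1 + q.1.2),
                   fun v => (1 + q.1.1) * ((1 + (q.2.2 v).1) * A v * (1 + (q.2.2 v).2)) * (1 + q.1.2)) := by
  sorry

/-- **Stub 2 (M/L, load-bearing) — flat local injectivity in orbit-section coordinates.**  For `C_v` with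
`C_v ∩ 𝔰_v = 0`, a slice `W` with `W ∩ T = 0`, `det x̃₀ = f ≠ 0` and RANK-INFINITESIMAL RIGIDITY of `x₀ = (Λ, A)`:
for `(c, (Λ', κ))` near `(1, 0)` with `κ_v ∈ C_v`, `w = (Λ', ((1+κ_v.1)A_v(1+κ_v.2) − A_v)_v) ∈ W` and
`det((x₀ + w)~) = c·f` force `(Λ', κ) = 0`.  Injective differential of
`(c, Λ', κ) ↦ ((Λ', σ(κ)) mod W, (det((x₀+w)(z)) − c·f(z))_{z ∈ S})` at `(1, 0, 0)` (Jacobi `hasFDerivAt_det_of_hasFDerivAt`,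
finitely many evaluation points `exists_finset_forall_mem`, the scalar direction `x₀ ∈ T` absorbs `γ`, rank-tangency of
`η.1 A_v + A_v η.2` is automatic) + `eventually_eq_of_hasFDerivAt_of_ker_eq_bot`. -/
theorem stub_rankLocInj :
    ∀ (ι : Type) [Fintype ι] (m : ℕ) (f : MvPolynomial ι ℂ) (Λ : Matrix (Fin m) (Fin m) ℂ) (A : ι → Matrix (Fin m) (Fin m) ℂ)
      (C : ι → Submodule ℂ (Matrix (Fin m) (Fin m) ℂ × Matrix (Fin m) (Fin m) ℂ))
      (W : Submodule ℂ (Matrix (Fin m) (Fin m) ℂ × (ι → Matrix (Fin m) (Fin m) ℂ))),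
      (∀ v, ∀ c ∈ C v, c.1 * A v + A v * c.2 = 0 → c = 0) →
      f ≠ 0 →
      (Λ.map MvPolynomial.C + ∑ v, (MvPolynomial.X v : MvPolynomial ι ℂ) • (A v).map MvPolynomial.C).det = f →
      (∀ (Λ' : Matrix (Fin m) (Fin m) ℂ) (A' : ι → Matrix (Fin m) (Fin m) ℂ),
        ((Λ.map MvPolynomial.C + ∑ v, (MvPolynomial.X v : MvPolynomial ι ℂ) • (A v).map MvPolynomial.C).adjugate
            * (Λ'.map MvPolynomial.C + ∑ v, (MvPolynomial.X v : MvPolynomial ι ℂ) • (A' v).map MvPolynomial.C)).trace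
          = (0 : MvPolynomial ι ℂ) →
        (∀ v w, (A v).mulVec w = 0 → ∃ u, (A' v).mulVec w = (A v).mulVec u) →
        ∃ P Q : Matrix (Fin m) (Fin m) ℂ, Λ' = P * Λ - Λ * Q ∧ ∀ v, A' v = P * A v - A v * Q) →
      (∀ (P Q : Matrix (Fin m) (Fin m) ℂ), ∀ w ∈ W,
        ((P * Λ + Λ * Q, fun v => P * A v + A v * Q) :
            Matrix (Fin m) (Fin m) ℂ × (ι → Matrix (Fin m) (Fin m) ℂ)) = w →
        w = 0) →
      ∃ N ∈ nhds ((1 : ℂ), (0 : Matrix (Fin m) (Fin m) ℂ × (ι → Matrix (Fin m) (Fin m) ℂ × Matrix (Fin m) (Fin m) ℂ))),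
        ∀ cq ∈ N, (∀ v, cq.2.2 v ∈ C v) →
          ((cq.2.1, fun v => (1 + (cq.2.2 v).1) * A v * (1 + (cq.2.2 v).2) - A v) :
              Matrix (Fin m) (Fin m) ℂ × (ι → Matrix (Fin m) (Fin m) ℂ)) ∈ W →
          ((Λ + cq.2.1).map MvPolynomial.C +
              ∑ v, (MvPolynomial.X v : MvPolynomial ι ℂ) •
                ((1 + (cq.2.2 v).1) * A v * (1 + (cq.2.2 v).2)).map MvPolynomial.C).det
            = MvPolynomial.C cq.1 * f →
          cq.2 = 0 := by
  sorry

/-- **Composition (kernel-checked): the two stubs give the item `RankInfRigidToLocallyOpen`** — the tree assembly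
`infRigidToLocallyOpen_of_slice` transplanted to orbit-section coordinates. -/
theorem RankInfRigidToLocallyOpen_of :
    Summit.ValiantsHypothesis.ValiantsHypothesis.Theses.RigidityForcesSymmetry.RankInfRigidToLocallyOpen := by
  intro ι _ m f Λ A hf hdet hT
  classical
  -- the gauge tangent map `τ (P, Q) = (PΛ + ΛQ, (P A_v + A_v Q)_v)` and a linear complement `W` of its range
  let τ : (Matrix (Fin m) (Fin m) ℂ × Matrix (Fin m) (Fin m) ℂ) →ₗ[ℂ]
      (Matrix (Fin m) (Fin m) ℂ × (ι → Matrix (Fin m) (Fin m) ℂ)) :=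
    ((LinearMap.mulRight ℂ Λ).comp (LinearMap.fst ℂ _ _) +
        (LinearMap.mulLeft ℂ Λ).comp (LinearMap.snd ℂ _ _)).prod
      (LinearMap.pi fun v =>
        (LinearMap.mulRight ℂ (A v)).comp (LinearMap.fst ℂ _ _) +
          (LinearMap.mulLeft ℂ (A v)).comp (LinearMap.snd ℂ _ _))
  have hτ : ∀ P Q : Matrix (Fin m) (Fin m) ℂ,
      τ (P, Q) = (P * Λ + Λ * Q, fun v => P * A v + A v * Q) := fun P Q => rfl
  obtain ⟨W, hW⟩ := Submodule.exists_isCompl (LinearMap.range τ)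
  have hsup : ∀ x : Matrix (Fin m) (Fin m) ℂ × (ι → Matrix (Fin m) (Fin m) ℂ),
      ∃ (P Q : Matrix (Fin m) (Fin m) ℂ), ∃ w ∈ W,
        x = (P * Λ + Λ * Q, fun v => P * A v + A v * Q) + w := by
    intro x
    have hx : x ∈ LinearMap.range τ ⊔ W := by rw [hW.sup_eq_top]; trivial
    obtain ⟨t, ht, w, hw, rfl⟩ := Submodule.mem_sup.1 hx
    obtain ⟨⟨P, Q⟩, rfl⟩ := LinearMap.mem_range.1 ht
    exact ⟨P, Q, w, hw, by rw [hτ]⟩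
  have hinf : ∀ (P Q : Matrix (Fin m) (Fin m) ℂ), ∀ w ∈ W,
      ((P * Λ + Λ * Q, fun v => P * A v + A v * Q) :
          Matrix (Fin m) (Fin m) ℂ × (ι → Matrix (Fin m) (Fin m) ℂ)) = w → w = 0 := by
    intro P Q w hw h
    have ht : w ∈ LinearMap.range τ := LinearMap.mem_range.2 ⟨(P, Q), by rw [hτ, h]⟩
    have hbot : w ∈ LinearMap.range τ ⊓ W := Submodule.mem_inf.2 ⟨ht, hw⟩
    rw [hW.inf_eq_bot] at hbot
    simpa using hbot
  -- orbit-section complements `C_v` and the constrained slice cover (stub 1); flat local injectivity (stub 2)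
  obtain ⟨Cv, hCv, hcov⟩ := stub_rankSliceCover ι m Λ A W hsup
  obtain ⟨N, hN, hJ'⟩ := stub_rankLocInj ι m f Λ A Cv W hCv hf hdet hT hinf
  -- the parameter neighbourhood `V` of `0`
  let κ : (Matrix (Fin m) (Fin m) ℂ × Matrix (Fin m) (Fin m) ℂ) ×
        (Matrix (Fin m) (Fin m) ℂ × (ι → Matrix (Fin m) (Fin m) ℂ × Matrix (Fin m) (Fin m) ℂ)) →
      ℂ × (Matrix (Fin m) (Fin m) ℂ × (ι → Matrix (Fin m) (Fin m) ℂ × Matrix (Fin m) (Fin m) ℂ)) :=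
    fun q => (((1 + q.1.1).det * (1 + q.1.2).det)⁻¹, q.2)
  have hc1 : Continuous fun q : (Matrix (Fin m) (Fin m) ℂ × Matrix (Fin m) (Fin m) ℂ) ×
      (Matrix (Fin m) (Fin m) ℂ × (ι → Matrix (Fin m) (Fin m) ℂ × Matrix (Fin m) (Fin m) ℂ)) => (1 + q.1.1).det :=
    (continuous_const.add (continuous_fst.comp continuous_fst)).matrix_det
  have hc2 : Continuous fun q : (Matrix (Fin m) (Fin m) ℂ × Matrix (Fin m) (Fin m) ℂ) ×
      (Matrix (Fin m) (Fin m) ℂ × (ι → Matrix (Fin m) (Fin m) ℂ × Matrix (Fin m) (Fin m) ℂ)) => (1 + q.1.2).det :=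
    (continuous_const.add (continuous_snd.comp continuous_fst)).matrix_det
  have hκ : ContinuousAt κ 0 := by
    refine ContinuousAt.prodMk ?_ continuous_snd.continuousAt
    refine ((hc1.mul hc2).continuousAt).inv₀ ?_
    simp
  have hκ0 : κ 0 = (1, 0) := by simp [κ]
  have hV1 : κ ⁻¹' N ∈ 𝓝 (0 : (Matrix (Fin m) (Fin m) ℂ × Matrix (Fin m) (Fin m) ℂ) ×
      (Matrix (Fin m) (Fin m) ℂ × (ι → Matrix (Fin m) (Fin m) ℂ × Matrix (Fin m) (Fin m) ℂ))) :=
    hκ.preimage_mem_nhds (by rw [hκ0]; exact hN)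
  have hV2 : ∀ᶠ q in 𝓝 (0 : (Matrix (Fin m) (Fin m) ℂ × Matrix (Fin m) (Fin m) ℂ) ×
      (Matrix (Fin m) (Fin m) ℂ × (ι → Matrix (Fin m) (Fin m) ℂ × Matrix (Fin m) (Fin m) ℂ))), (1 + q.1.1).det ≠ 0 :=
    hc1.continuousAt.eventually_ne (by simp)
  have hV3 : ∀ᶠ q in 𝓝 (0 : (Matrix (Fin m) (Fin m) ℂ × Matrix (Fin m) (Fin m) ℂ) ×
      (Matrix (Fin m) (Fin m) ℂ × (ι → Matrix (Fin m) (Fin m) ℂ × Matrix (Fin m) (Fin m) ℂ))), (1 + q.1.2).det ≠ 0 :=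
    hc2.continuousAt.eventually_ne (by simp)
  obtain ⟨U, hU, hU'⟩ := hcov _ (inter_mem hV1 (hV2.and hV3))
  refine ⟨U, hU, fun p hp hpdet hprank => ?_⟩
  obtain ⟨q, ⟨hq1, hq2, hq3⟩, hqC, hqW, rfl⟩ := hU' p hp hprank
  -- `det p̃ = det(1+P) · det((x₀+w)~) · det(1+Q)`
  have hpencil := Summit.ValiantsHypothesis.ValiantsHypothesis.Theorems.rft_map_C_mul_pencil_mul_map_C
    (1 + q.1.1) (1 + q.1.2) (Λ + q.2.1) (fun v => (1 + (q.2.2 v).1) * A v * (1 + (q.2.2 v).2))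
  dsimp only at hpdet
  rw [← hpencil, det_mul, det_mul] at hpdet
  have hmapdet : ∀ N : Matrix (Fin m) (Fin m) ℂ,
      (N.map (C : ℂ →+* MvPolynomial ι ℂ)).det = (C N.det : MvPolynomial ι ℂ) := fun N => by
    rw [← RingHom.mapMatrix_apply, ← RingHom.map_det]
  rw [hmapdet, hmapdet] at hpdet
  have hab : (1 + q.1.1).det * (1 + q.1.2).det ≠ 0 := mul_ne_zero hq2 hq3
  have key : ((Λ + (κ q).2.1).map MvPolynomial.C +
        ∑ v, (MvPolynomial.X v : MvPolynomial ι ℂ) •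
          ((1 + ((κ q).2.2 v).1) * A v * (1 + ((κ q).2.2 v).2)).map MvPolynomial.C).det
      = MvPolynomial.C (κ q).1 * f := by
    show ((Λ + q.2.1).map C +
        ∑ v, (X v : MvPolynomial ι ℂ) • ((1 + (q.2.2 v).1) * A v * (1 + (q.2.2 v).2)).map C).det
      = C ((1 + q.1.1).det * (1 + q.1.2).det)⁻¹ * f
    rw [← hpdet]
    set D : MvPolynomial ι ℂ :=
      ((Λ + q.2.1).map C +
        ∑ v, (X v : MvPolynomial ι ℂ) • ((1 + (q.2.2 v).1) * A v * (1 + (q.2.2 v).2)).map C).det with hD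
    calc D = C (((1 + q.1.1).det * (1 + q.1.2).det)⁻¹ * ((1 + q.1.1).det * (1 + q.1.2).det)) * D := by
          rw [inv_mul_cancel₀ hab, C_1, one_mul]
      _ = C ((1 + q.1.1).det * (1 + q.1.2).det)⁻¹ * (C (1 + q.1.1).det * D * C (1 + q.1.2).det) := by
          rw [C_mul, C_mul]; ring
  have hw0 : q.2 = 0 := hJ' (κ q) hq1 hqC hqW key
  have hw1 : q.2.1 = 0 := by rw [hw0]; rfl
  have hw2 : ∀ v, q.2.2 v = 0 := fun v => by rw [hw0]; rfl
  refine ⟨Matrix.GeneralLinearGroup.mkOfDetNeZero _ hq2,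
    (Matrix.GeneralLinearGroup.mkOfDetNeZero _ hq3)⁻¹, ?_, fun v => ?_⟩
  · simp [hw1, Matrix.GeneralLinearGroup.mkOfDetNeZero]
  · simp [hw2 v, Matrix.GeneralLinearGroup.mkOfDetNeZero]

end Summit.ValiantsHypothesis.ValiantsHypothesis.Cruxes.RankInfRigidToLocallyOpen.RankSlice

end
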